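/- Free-seat work of EXTRA WIDTH SEAT `ym-line-cbag-p1-w4` (prover-ym-line-cbag-p1-w4-g2-0), route `EguchiKawaiDirectionLadder`
(ideator ym-idea-2, LINE 8), crux `TripleSmallBallMargin` (stmt-QuantumFields-27724), skeleton v6 / LEAD's ARCH note: basic facts about
the RANK-ROBUST commutator event of (a♯), (E_rob), (Ψ_rob) — conjugation invariance (so the class-function reduction `firstFibre_conj`
applies) and CLOSEDNESS (so it is measurable and Fubini / `ekHaar_succ_eq_lintegral_firstFibre` apply).  ROUTE-INDEPENDENT.
Nothing here bears on the Yang–Mills mass gap. -/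
import Summits.QuantumFields.YangMills.Theorems.EguchiKawaiDirectionLadderHaarAbsorption
import Summits.QuantumFields.YangMills.Theorems.EguchiKawaiDirectionLadderBlockCompression
import Mathlib.Analysis.Normed.Module.FiniteDimension
import HarnessLib

/-!
# Route `EguchiKawaiDirectionLadder`: the rank-robust commutator event is a closed class event

The rank-robust events of skeleton v6 / the LEAD's (E_rob), (Ψ_rob) have the shape
`RobustCommEvent d N b s := {U : U(N)^d | ∃ R : Fin d → Fin d → M_N(ℂ), (∀ μ ν, rank (R μ ν) ≤ b) ∧ Σ_{μν} ‖[U_μ,U_ν] − R μ ν‖_F² ≤ s}`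
(stated below as a set-builder, no new definition).  This file proves:

* CONJUGATION INVARIANCE (`robustComm_conj`): `U ∈ event ⇒ (V U_μ V⁻¹)_μ ∈ event` (take `R ↦ V R V⁻¹`: `ekComm_conj`, `frobSq_conj`,
  `rank_conj_unitary`) — hence `firstFibre_conj` / `haar_pair_conj`-type reductions to a diagonal first link apply;
* RANK SEMICONTINUITY (`isClosed_setOf_rank_le`, `isClosed_setOf_rank_le_real`): `{L : M_n(ℂ) | rank L ≤ r}` is closed (Mathlib's
  `isOpen_setOf_nat_le_rank` for continuous linear maps, transported along `L ↦ mulVecLin L`);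
* A PRIORI BOUND (`frobSq_ekComm_le`): `‖[U_μ,U_ν]‖_F² ≤ 4N`, so the witnesses `R` may be taken in a compact ball;
* CLOSEDNESS and MEASURABILITY (`isClosed_robustCommEvent`, `measurableSet_robustCommEvent`): the event is the projection of a compact set.

HONEST FRAMING: topology/linear algebra bookkeeping; no small-ball estimate.  The route bears on the barrier-ledger fact `EguchiKawaiBreakdown`.
-/

set_option autoImplicit false

noncomputable section

open MeasureTheory
open scoped Matrix
open Literature.Barriers.QuantumFields

namespace Summit.QuantumFields.YangMills.Theorems.EguchiKawaiDirectionLadder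

variable {d N : ℕ}

/-! ### §1 Conjugation invariance -/

/-- The commutator of conjugated links: `[V U_μ V⁻¹, V U_ν V⁻¹] = V [U_μ, U_ν] V⁻¹`. -/
theorem ekComm_conj (V : UN N) (U : EKConfig d N) (μ ν : Fin d) :
    ekComm (fun α => V * U α * V⁻¹) μ ν =
      (V : Matrix (Fin N) (Fin N) ℂ) * ekComm U μ ν * star (V : Matrix (Fin N) (Fin N) ℂ) := by
  unfold ekComm
  simp only [coe_conj_link, conj_mul_conj]
  rw [Matrix.mul_sub, Matrix.sub_mul]

/-- `frobSq` is the real part of `tr(A A†)`. -/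
theorem frobSq_eq_re_trace (A : Matrix (Fin N) (Fin N) ℂ) : frobSq A = (Matrix.trace (A * Aᴴ)).re := by
  rw [re_trace_mul_conjTranspose_eq_sum]; rfl

/-- Conjugation by a unitary preserves the Frobenius mass: `‖V M V⁻¹‖_F² = ‖M‖_F²`. -/
theorem frobSq_conj (V : UN N) (M : Matrix (Fin N) (Fin N) ℂ) :
    frobSq ((V : Matrix (Fin N) (Fin N) ℂ) * M * star (V : Matrix (Fin N) (Fin N) ℂ)) = frobSq M := by
  rw [frobSq_eq_re_trace, frobSq_eq_re_trace, conjTranspose_conj, conj_mul_conj, trace_conj]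

/-- A unitary matrix is a unit. -/
theorem isUnit_det_coe (V : UN N) : IsUnit (V : Matrix (Fin N) (Fin N) ℂ).det := by
  rw [← Matrix.isUnit_iff_isUnit_det]
  refine ⟨⟨(V : Matrix (Fin N) (Fin N) ℂ), star (V : Matrix (Fin N) (Fin N) ℂ), ?_, ?_⟩, rfl⟩
  · exact Matrix.mem_unitaryGroup_iff.mp V.2
  · exact Matrix.mem_unitaryGroup_iff'.mp V.2

/-- Conjugation by a unitary preserves the rank. -/
theorem rank_conj_unitary (V : UN N) (M : Matrix (Fin N) (Fin N) ℂ) :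
    ((V : Matrix (Fin N) (Fin N) ℂ) * M * star (V : Matrix (Fin N) (Fin N) ℂ)).rank = M.rank := by
  have h1 : IsUnit (star (V : Matrix (Fin N) (Fin N) ℂ)).det := by
    have := isUnit_det_coe V⁻¹
    rwa [Matrix.UnitaryGroup.inv_val] at this
  rw [Matrix.rank_mul_eq_left_of_isUnit_det _ _ h1, Matrix.rank_mul_eq_right_of_isUnit_det _ _ (isUnit_det_coe V)]

/-- **The rank-robust commutator event is a class event**: if `U` admits witnesses `R μ ν` of rank `≤ b μ ν` with
`Σ‖[U_μ,U_ν] − R μ ν‖_F² ≤ s`, so does every simultaneous conjugate of `U` (witnesses `V R V⁻¹`). -/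
theorem robustComm_conj (V : UN N) (U : EKConfig d N) {b : Fin d → Fin d → ℝ} {s : ℝ}
    (hU : ∃ R : Fin d → Fin d → Matrix (Fin N) (Fin N) ℂ, (∀ μ ν, ((R μ ν).rank : ℝ) ≤ b μ ν) ∧
      ∑ μ, ∑ ν, frobSq (ekComm U μ ν - R μ ν) ≤ s) :
    ∃ R : Fin d → Fin d → Matrix (Fin N) (Fin N) ℂ, (∀ μ ν, ((R μ ν).rank : ℝ) ≤ b μ ν) ∧
      ∑ μ, ∑ ν, frobSq (ekComm (fun α => V * U α * V⁻¹) μ ν - R μ ν) ≤ s := by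
  obtain ⟨R, hR, hs⟩ := hU
  refine ⟨fun μ ν => (V : Matrix (Fin N) (Fin N) ℂ) * R μ ν * star (V : Matrix (Fin N) (Fin N) ℂ), fun μ ν => ?_, ?_⟩
  · rw [rank_conj_unitary]; exact hR μ ν
  · have h : ∀ μ ν, frobSq (ekComm (fun α => V * U α * V⁻¹) μ ν -
        (V : Matrix (Fin N) (Fin N) ℂ) * R μ ν * star (V : Matrix (Fin N) (Fin N) ℂ)) = frobSq (ekComm U μ ν - R μ ν) := by
      intro μ ν
      rw [ekComm_conj, ← frobSq_conj V (ekComm U μ ν - R μ ν), Matrix.mul_sub, Matrix.sub_mul]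
    simp_rw [h]; exact hs

/-! ### §2 Lower semicontinuity of the rank -/

section Rank

variable {n : Type} [Fintype n]

/-- `{L | k ≤ rank L}` is open (`L ↦ mulVecLin L` is a continuous linear map into the continuous linear maps, and
Mathlib's `isOpen_setOf_nat_le_rank`). -/
theorem isOpen_setOf_le_rank (k : ℕ) : IsOpen {L : Matrix n n ℂ | k ≤ L.rank} := by
  let Φ : Matrix n n ℂ →ₗ[ℂ] ((n → ℂ) →L[ℂ] (n → ℂ)) :=
    { toFun := fun L => LinearMap.toContinuousLinearMap (Matrix.mulVecLin L)
      map_add' := fun L L' => by ext v i; simp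
      map_smul' := fun c L => by ext v i; simp }
  have hc : Continuous Φ := Φ.continuous_of_finiteDimensional
  have h := (isOpen_setOf_nat_le_rank (𝕜 := ℂ) (E := n → ℂ) (F := n → ℂ) k).preimage hc
  convert h using 1
  ext L
  simp only [Set.mem_setOf_eq, Set.mem_preimage]
  show k ≤ L.rank ↔ (k : Cardinal) ≤ (Matrix.mulVecLin L).rank
  rw [Matrix.rank, LinearMap.rank, ← Module.finrank_eq_rank, Nat.cast_le]

/-- **`{L | rank L ≤ r}` is closed** (lower semicontinuity of the rank). -/
theorem isClosed_setOf_rank_le (r : ℕ) : IsClosed {L : Matrix n n ℂ | L.rank ≤ r} := by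
  have h := (isOpen_setOf_le_rank (n := n) (r + 1)).isClosed_compl
  convert h using 1
  ext L
  simp only [Set.mem_setOf_eq, Set.mem_compl_iff, not_le]
  omega

/-- Real-threshold version: `{L | (rank L : ℝ) ≤ b}` is closed. -/
theorem isClosed_setOf_rank_le_real (b : ℝ) : IsClosed {L : Matrix n n ℂ | (L.rank : ℝ) ≤ b} := by
  by_cases hb : 0 ≤ b
  · convert isClosed_setOf_rank_le (n := n) ⌊b⌋₊ using 1
    ext L
    simp only [Set.mem_setOf_eq]
    rw [Nat.le_floor_iff hb]
  · convert isClosed_empty using 1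
    ext L
    simp only [Set.mem_setOf_eq, Set.mem_empty_iff_false, iff_false, not_le]
    exact lt_of_lt_of_le (lt_of_not_ge hb) (Nat.cast_nonneg _)

end Rank

/-! ### §3 The event is closed, hence measurable -/

/-- A priori bound: `‖[U_μ, U_ν]‖_F² ≤ 4N`. -/
theorem frobSq_ekComm_le (U : EKConfig d N) (μ ν : Fin d) : frobSq (ekComm U μ ν) ≤ 4 * N := by
  rw [← ekCommNormSq_eq_frobSq, ekCommNormSq_eq]
  have h := re_trace_le (-((U ν)⁻¹ * (U μ)⁻¹ * U ν * U μ))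
  have hre : -(N : ℝ) ≤ (ekPlaqTrace U μ ν).re := by
    have hneg : ((-((U ν)⁻¹ * (U μ)⁻¹ * U ν * U μ) : UN N) : Matrix (Fin N) (Fin N) ℂ) =
        -(((U ν)⁻¹ * (U μ)⁻¹ * U ν * U μ : UN N) : Matrix (Fin N) (Fin N) ℂ) := rfl
    rw [hneg, Matrix.trace_neg, Complex.neg_re] at h
    have : (ekPlaqTrace U μ ν) = Matrix.trace (((U ν)⁻¹ * (U μ)⁻¹ * U ν * U μ : UN N) : Matrix (Fin N) (Fin N) ℂ) := by
      unfold ekPlaqTrace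
      simp [Matrix.star_eq_conjTranspose]
    rw [this]; linarith
  linarith

/-- **The rank-robust commutator event is closed.**  It is the projection to `U(N)^d` of the compact set of pairs `(U, R)` with
`rank (R μ ν) ≤ b μ ν`, `Σ‖[U_μ,U_ν] − R μ ν‖² ≤ s` and the (automatic) entrywise bound `|R μ ν i j| ≤ √(2(4N + s))`. -/
theorem isClosed_robustCommEvent (b : Fin d → Fin d → ℝ) (s : ℝ) :
    IsClosed {U : EKConfig d N | ∃ R : Fin d → Fin d → Matrix (Fin N) (Fin N) ℂ,
      (∀ μ ν, ((R μ ν).rank : ℝ) ≤ b μ ν) ∧ ∑ μ, ∑ ν, frobSq (ekComm U μ ν - R μ ν) ≤ s} := by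
  classical
  -- the compact parameter set (entrywise bound) and the closed relation
  set B : ℝ := 2 * (4 * N + s) with hB
  set S : Set (Fin d → Fin d → Matrix (Fin N) (Fin N) ℂ) := {R | ∀ μ ν i j, ‖R μ ν i j‖ ≤ Real.sqrt B} with hS
  set K : Set (EKConfig d N × (Fin d → Fin d → Matrix (Fin N) (Fin N) ℂ)) :=
    {p | (∀ μ ν, ((p.2 μ ν).rank : ℝ) ≤ b μ ν) ∧ ∑ μ, ∑ ν, frobSq (ekComm p.1 μ ν - p.2 μ ν) ≤ s ∧ p.2 ∈ S} with hK
  -- continuity of the ingredients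
  have hcomm : ∀ μ ν : Fin d, Continuous fun U : EKConfig d N => ekComm U μ ν := by
    intro μ ν
    unfold ekComm
    exact ((continuous_coeLink μ).mul (continuous_coeLink ν)).sub ((continuous_coeLink ν).mul (continuous_coeLink μ))
  have hentry : ∀ i j : Fin N, Continuous fun M : Matrix (Fin N) (Fin N) ℂ => M i j := fun i j =>
    (continuous_apply j).comp (continuous_apply i)
  have hfrob : Continuous fun M : Matrix (Fin N) (Fin N) ℂ => frobSq M := by
    unfold frobSq
    refine continuous_finsetSum _ fun i _ => continuous_finsetSum _ fun j _ => ?_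
    exact (hentry i j).norm.pow 2
  have hR : ∀ μ ν : Fin d, Continuous fun R : Fin d → Fin d → Matrix (Fin N) (Fin N) ℂ => R μ ν := fun μ ν =>
    (continuous_apply ν).comp (continuous_apply μ)
  -- `S` is compact: a closed subset of a product of closed discs
  have hSclosed : IsClosed S := by
    rw [hS, show {R : Fin d → Fin d → Matrix (Fin N) (Fin N) ℂ | ∀ μ ν i j, ‖R μ ν i j‖ ≤ Real.sqrt B} =
      ⋂ μ, ⋂ ν, ⋂ i, ⋂ j, {R | ‖R μ ν i j‖ ≤ Real.sqrt B} by ext R; simp]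
    exact isClosed_iInter fun μ => isClosed_iInter fun ν => isClosed_iInter fun i => isClosed_iInter fun j =>
      isClosed_le (((hentry i j).comp (hR μ ν)).norm) continuous_const
  have hScpt : IsCompact S := by
    have hbig : IsCompact (Set.pi Set.univ fun _ : Fin d => Set.pi Set.univ fun _ : Fin d =>
        Set.pi Set.univ fun _ : Fin N => Set.pi Set.univ fun _ : Fin N => Metric.closedBall (0 : ℂ) (Real.sqrt B) :
        Set (Fin d → Fin d → Matrix (Fin N) (Fin N) ℂ)) :=
      isCompact_univ_pi fun _ => isCompact_univ_pi fun _ => isCompact_univ_pi fun _ => isCompact_univ_pi fun _ =>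
        isCompact_closedBall _ _
    refine hbig.of_isClosed_subset hSclosed fun R hRS => ?_
    refine Set.mem_pi.2 fun μ _ => Set.mem_pi.2 fun ν _ => Set.mem_pi.2 fun i _ => Set.mem_pi.2 fun j _ => ?_
    rw [Metric.mem_closedBall, dist_zero_right]
    exact hRS μ ν i j
  -- `K` is closed, contained in `univ ×ˢ S`, hence compact
  have hKclosed : IsClosed K := by
    have h1 : IsClosed {p : EKConfig d N × (Fin d → Fin d → Matrix (Fin N) (Fin N) ℂ) | ∀ μ ν, ((p.2 μ ν).rank : ℝ) ≤ b μ ν} := by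
      rw [show {p : EKConfig d N × (Fin d → Fin d → Matrix (Fin N) (Fin N) ℂ) | ∀ μ ν, ((p.2 μ ν).rank : ℝ) ≤ b μ ν} =
        ⋂ μ, ⋂ ν, (fun p => p.2 μ ν) ⁻¹' {L : Matrix (Fin N) (Fin N) ℂ | (L.rank : ℝ) ≤ b μ ν} by ext p; simp]
      exact isClosed_iInter fun μ => isClosed_iInter fun ν =>
        (isClosed_setOf_rank_le_real (b μ ν)).preimage ((hR μ ν).comp continuous_snd)
    have h2 : IsClosed {p : EKConfig d N × (Fin d → Fin d → Matrix (Fin N) (Fin N) ℂ) |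
        ∑ μ, ∑ ν, frobSq (ekComm p.1 μ ν - p.2 μ ν) ≤ s} :=
      isClosed_le (continuous_finsetSum _ fun μ _ => continuous_finsetSum _ fun ν _ =>
        hfrob.comp (((hcomm μ ν).comp continuous_fst).sub ((hR μ ν).comp continuous_snd))) continuous_const
    have h3 : IsClosed {p : EKConfig d N × (Fin d → Fin d → Matrix (Fin N) (Fin N) ℂ) | p.2 ∈ S} :=
      hSclosed.preimage continuous_snd
    have : K = {p | ∀ μ ν, ((p.2 μ ν).rank : ℝ) ≤ b μ ν} ∩
        ({p | ∑ μ, ∑ ν, frobSq (ekComm p.1 μ ν - p.2 μ ν) ≤ s} ∩ {p | p.2 ∈ S}) := by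
      ext p; simp [hK]
    rw [this]
    exact h1.inter (h2.inter h3)
  have hKcpt : IsCompact K :=
    (isCompact_univ.prod hScpt).of_isClosed_subset hKclosed fun p hp => ⟨Set.mem_univ _, hp.2.2⟩
  -- the event is the projection of `K`
  have himage : {U : EKConfig d N | ∃ R : Fin d → Fin d → Matrix (Fin N) (Fin N) ℂ,
      (∀ μ ν, ((R μ ν).rank : ℝ) ≤ b μ ν) ∧ ∑ μ, ∑ ν, frobSq (ekComm U μ ν - R μ ν) ≤ s} = Prod.fst '' K := by
    ext U
    simp only [Set.mem_setOf_eq, Set.mem_image, Prod.exists, exists_and_right, exists_eq_right, hK]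
    constructor
    · rintro ⟨R, hrank, hs⟩
      refine ⟨R, hrank, hs, fun μ ν i j => ?_⟩
      -- a priori bound on the witness
      have hsum : frobSq (ekComm U μ ν - R μ ν) ≤ s := by
        have h1 : frobSq (ekComm U μ ν - R μ ν) ≤ ∑ ν', frobSq (ekComm U μ ν' - R μ ν') :=
          Finset.single_le_sum (f := fun ν' => frobSq (ekComm U μ ν' - R μ ν')) (fun ν' _ => frobSq_nonneg _)
            (Finset.mem_univ ν)
        have h2 : ∑ ν', frobSq (ekComm U μ ν' - R μ ν') ≤ ∑ μ', ∑ ν', frobSq (ekComm U μ' ν' - R μ' ν') :=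
          Finset.single_le_sum (f := fun μ' => ∑ ν', frobSq (ekComm U μ' ν' - R μ' ν'))
            (fun μ' _ => Finset.sum_nonneg fun ν' _ => frobSq_nonneg _) (Finset.mem_univ μ)
        linarith
      have hsub : frobSq (R μ ν) ≤ 2 * frobSq (ekComm U μ ν) + 2 * frobSq (ekComm U μ ν - R μ ν) := by
        have h := frobSq_sub_le (ekComm U μ ν) (ekComm U μ ν - R μ ν)
        rwa [sub_sub_cancel] at h
      have h4 := frobSq_ekComm_le U μ ν
      have hfro : frobSq (R μ ν) ≤ B := by rw [hB]; linarith
      have hij : ‖R μ ν i j‖ ^ 2 ≤ frobSq (R μ ν) := by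
        have h1 : ‖R μ ν i j‖ ^ 2 ≤ ∑ j', ‖R μ ν i j'‖ ^ 2 :=
          Finset.single_le_sum (f := fun j' => ‖R μ ν i j'‖ ^ 2) (fun j' _ => by positivity) (Finset.mem_univ j)
        have h2 : ∑ j', ‖R μ ν i j'‖ ^ 2 ≤ ∑ i', ∑ j', ‖R μ ν i' j'‖ ^ 2 :=
          Finset.single_le_sum (f := fun i' => ∑ j', ‖R μ ν i' j'‖ ^ 2)
            (fun i' _ => Finset.sum_nonneg fun j' _ => by positivity) (Finset.mem_univ i)
        exact h1.trans h2
      have := Real.abs_le_sqrt (hij.trans hfro)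
      rwa [abs_norm] at this
    · rintro ⟨R, hrank, hs, -⟩
      exact ⟨R, hrank, hs⟩
  rw [himage]
  exact (hKcpt.image continuous_fst).isClosed

/-- **The rank-robust commutator event is measurable.** -/
theorem measurableSet_robustCommEvent (b : Fin d → Fin d → ℝ) (s : ℝ) :
    MeasurableSet {U : EKConfig d N | ∃ R : Fin d → Fin d → Matrix (Fin N) (Fin N) ℂ,
      (∀ μ ν, ((R μ ν).rank : ℝ) ≤ b μ ν) ∧ ∑ μ, ∑ ν, frobSq (ekComm U μ ν - R μ ν) ≤ s} :=
  (isClosed_robustCommEvent b s).measurableSet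

end Summit.QuantumFields.YangMills.Theorems.EguchiKawaiDirectionLadder

end
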